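import Summits.KontsevichZagierPeriods.KontsevichZagierPeriods.Theorems.ValuedFieldSpecialisationClassLevelExpansionFibreDimOneElementaryB
import Summits.KontsevichZagierPeriods.KontsevichZagierPeriods.Theorems.ValuedFieldSpecialisationClassLevelExpansionFibreDimOneRpow
import Summits.KontsevichZagierPeriods.KontsevichZagierPeriods.Theorems.ValuedFieldSpecialisationClassLevelExpansionFibreDimOneMonomial

/-!
# Route ValuedFieldSpecialisation — crux `CTConstruction`: the fibre representation of the blow-up exists

Helper toward crux stmt-KontsevichZagierPeriods-3495 (`CTConstruction`), line `registered`,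
reshape r4 (blow-up elimination of the log block), stub `stub_exists_blowupFibreRep`. The
**fibre representation** `W = W_m(p, q, r)` carried by the pieces of the blow-up of an elementary
divergent product over a representation `r` of dimension `d` has dimension `m + d + 1`,
coordinates `v = (s', η₁…η_m, x)` (`s' = v 0`, the block `η : Fin m → ℝ` at the indices
`(Fin.castAdd d l).succ`, the fibre `x : Fin d → ℝ` at the indices `(Fin.natAdd m i).succ`),
domain `0 < s' < 1`, `s' ≤ η_l ≤ 1`, `x ∈ r.domain`, and integrand
`s' ^ (1 − p/q) · ∏ η_l⁻¹ · r.integrand x`. This file proves its EXISTENCE for `p < q`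
(`stub_exists_blowupFibreRep`): the domain is the monomial-log domain of
`ValuedFieldSpecialisationClassLevelExpansionFibreDimOneMonomial` (`monomialDomain_eq`,
`isSemialgebraic_monomialDomain`), the integrand is `ℚ`-semialgebraic on it (a rational power of
the positive coordinate `v 0`, `isSemialgebraicFunOn_rpow_coord_rat`, times the elementary
integrand), and it is absolutely integrable because on the domain `0 < v 0 < 1`, so that
`(v 0) ^ (1 − p/q) ≤ (v 0) ^ (−p/q)` and the integrand is dominated in absolute value by the
monomial-log integrand `s ^ (−p/q) · ∏ η_l⁻¹ · r.integrand x`, integrable for `p < q`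
(`integrableOn_monomialIntegrand`).

Sources: M. Kontsevich, D. Zagier, *Periods* (2001), §1.2 (absolutely convergent integrals of
semialgebraic functions; the blow-up belongs to rule (2), change of variables); J. Bochnak,
M. Coste, M.-F. Roy, *Real Algebraic Geometry* (1998), §2.2 (Prop. 2.2.6, semialgebraic maps and
functions). No new definitions.
-/

noncomputable section

namespace Summit.KontsevichZagierPeriods.ValuedFieldSpecialisation

open MeasureTheory Set Filter
open scoped Topology
open Literature.NumberTheory.Transcendental Literature.NumberTheory.Transcendental.KZ
open Literature.ModelTheory.ExponentialFields (IsSemialgebraic)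

/-! ## The integrand of the fibre representation -/

/-- The integrand `s' ^ (1 − p/q) · ∏ η_l⁻¹ · r.integrand x` of the fibre representation is
`ℚ`-semialgebraic on the monomial-log domain (in coordinates): a rational power of the positive
coordinate `v 0` times a product of inverses of non-vanishing coordinates times `r.integrand`
read through a selection of coordinates. [Bochnak–Coste–Roy 1998, Prop. 2.2.6] [folklore] -/
theorem isSemialgebraicFunOn_blowupFibreIntegrand {d : ℕ} (p q m : ℕ) (r : IntegralRep d) :
    IsSemialgebraicFunOn ℚ {v : Fin (m + d + 1) → ℝ | 0 < v 0 ∧ v 0 < 1 ∧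
      (∀ j : Fin m, v 0 ≤ v (Fin.castAdd d j).succ ∧ v (Fin.castAdd d j).succ ≤ 1) ∧
      (fun l : Fin d => v (Fin.natAdd m l).succ) ∈ r.domain}
      (fun v => v 0 ^ ((1 - (p : ℚ) / q : ℚ) : ℝ) * ((∏ l : Fin m, (v (Fin.castAdd d l).succ)⁻¹) *
        r.integrand (fun i : Fin d => v (Fin.natAdd m i).succ))) := by
  have hD := isSemialgebraic_monomialDomain m r
  refine IsSemialgebraicFunOn.mul_holds
    (isSemialgebraicFunOn_rpow_coord_rat hD 0 (fun v hv => hv.1) (1 - (p : ℚ) / q))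
    (IsSemialgebraicFunOn.mul_holds ?_ ?_)
  · exact isSemialgebraicFunOn_finset_prod' hD Finset.univ _ fun j _ =>
      (isSemialgebraicFunOn_apply hD _).inv fun v hv => (hv.1.trans_le (hv.2.2.1 j).1).ne'
  · exact (isSemialgebraicFunOn_comp_coords r.isSemialgebraicFunOn_integrand
      (fun l : Fin d => (Fin.natAdd m l).succ)).mono (fun v hv => hv.2.2.2) hD

/-- **Integrability of the fibre representation** (`p < q`): on the monomial-log domain
`0 < v 0 < 1`, hence `(v 0) ^ (1 − p/q) ≤ (v 0) ^ (−p/q)` and the integrand of the fibre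
representation is dominated in absolute value by the monomial-log integrand
`s ^ (−p/q) · ∏ η_l⁻¹ · r.integrand x`, which is integrable there. [folklore] -/
theorem integrableOn_blowupFibreIntegrand {d p q m : ℕ} (hpq : p < q) (r : IntegralRep d) :
    IntegrableOn (fun v : Fin (m + d + 1) → ℝ => v 0 ^ ((1 - (p : ℚ) / q : ℚ) : ℝ) *
        ((∏ l : Fin m, (v (Fin.castAdd d l).succ)⁻¹) *
          r.integrand (fun i : Fin d => v (Fin.natAdd m i).succ)))
      {v | 0 < v 0 ∧ v 0 < 1 ∧
        (∀ j : Fin m, v 0 ≤ v (Fin.castAdd d j).succ ∧ v (Fin.castAdd d j).succ ≤ 1) ∧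
        (fun l : Fin d => v (Fin.natAdd m l).succ) ∈ r.domain} := by
  set D := {v : Fin (m + d + 1) → ℝ | 0 < v 0 ∧ v 0 < 1 ∧
    (∀ j : Fin m, v 0 ≤ v (Fin.castAdd d j).succ ∧ v (Fin.castAdd d j).succ ≤ 1) ∧
    (fun l : Fin d => v (Fin.natAdd m l).succ) ∈ r.domain} with hD
  have hDsa : IsSemialgebraic ℚ D := isSemialgebraic_monomialDomain m r
  have hDm : MeasurableSet D := IsSemialgebraic.measurableSet_holds hDsa
  have hFsa := isSemialgebraicFunOn_blowupFibreIntegrand p q m r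
  have hmeas := hFsa.measurable_indicator_of_tarskiSeidenberg
    Literature.ModelTheory.ExponentialFields.tarski_seidenberg_real_holds hDm
  have hg : IntegrableOn (fun v : Fin (m + d + 1) → ℝ => (v 0) ^ (-(p : ℝ) / q) *
      ((∏ j : Fin m, (v (Fin.castAdd d j).succ)⁻¹) *
        r.integrand (fun l : Fin d => v (Fin.natAdd m l).succ))) D :=
    integrableOn_monomialIntegrand hpq r
  have hexp : (-(p : ℝ) / q) ≤ ((1 - (p : ℚ) / q : ℚ) : ℝ) := by
    push_cast
    rw [neg_div]
    linarith
  refine Integrable.mono hg ((aestronglyMeasurable_indicator_iff hDm).mp hmeas.aestronglyMeasurable)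
    (ae_restrict_of_forall_mem hDm fun v hv => ?_)
  obtain ⟨hs0, hs1, _, _⟩ := hv
  have hpow : v 0 ^ ((1 - (p : ℚ) / q : ℚ) : ℝ) ≤ v 0 ^ (-(p : ℝ) / q) :=
    Real.rpow_le_rpow_of_exponent_ge hs0 hs1.le hexp
  calc ‖v 0 ^ ((1 - (p : ℚ) / q : ℚ) : ℝ) * ((∏ l : Fin m, (v (Fin.castAdd d l).succ)⁻¹) *
          r.integrand (fun i : Fin d => v (Fin.natAdd m i).succ))‖
      = v 0 ^ ((1 - (p : ℚ) / q : ℚ) : ℝ) * |(∏ l : Fin m, (v (Fin.castAdd d l).succ)⁻¹) *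
          r.integrand (fun i : Fin d => v (Fin.natAdd m i).succ)| := by
        rw [Real.norm_eq_abs, abs_mul, abs_of_nonneg (Real.rpow_nonneg hs0.le _)]
    _ ≤ v 0 ^ (-(p : ℝ) / q) * |(∏ l : Fin m, (v (Fin.castAdd d l).succ)⁻¹) *
          r.integrand (fun i : Fin d => v (Fin.natAdd m i).succ)| :=
        mul_le_mul_of_nonneg_right hpow (abs_nonneg _)
    _ = ‖v 0 ^ (-(p : ℝ) / q) * ((∏ l : Fin m, (v (Fin.castAdd d l).succ)⁻¹) *
          r.integrand (fun i : Fin d => v (Fin.natAdd m i).succ))‖ := by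
        rw [Real.norm_eq_abs, abs_mul (v 0 ^ (-(p : ℝ) / q)),
          abs_of_nonneg (Real.rpow_nonneg hs0.le _)]

/-! ## Existence -/

/-- **The fibre representation of the blow-up exists.** For `p < q`, every `m`, and every
representation `r` of dimension `d`, there is an integral representation `W` of dimension
`m + d + 1` whose domain and integrand are LITERALLY
`{(s', η, x) | 0 < s' < 1, s' ≤ η_l ≤ 1, x ∈ r.domain}` and
`s' ^ (1 − p/q) · ∏ η_l⁻¹ · r.integrand x`. [Kontsevich–Zagier 2001, §1.2] [folklore] -/
theorem stub_exists_blowupFibreRep : ∀ (p q m d : ℕ) (r : Literature.NumberTheory.Transcendental.KZ.IntegralRep d), p < q → ∃ W : Literature.NumberTheory.Transcendental.KZ.IntegralRep (m + d + 1), W.domain = {v | ∃ (s' : ℝ) (η : Fin m → ℝ) (x : Fin d → ℝ), v = Matrix.vecCons s' (Fin.append η x) ∧ 0 < s' ∧ s' < 1 ∧ (∀ l, s' ≤ η l ∧ η l ≤ 1) ∧ x ∈ r.domain} ∧ W.integrand = (fun v => v 0 ^ ((1 - (p : ℚ) / q : ℚ) : ℝ) * ((∏ l : Fin m, (v (Fin.castAdd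 d l).succ)⁻¹) * r.integrand (fun i : Fin d => v (Fin.natAdd m i).succ))) := by
  intro p q m d r hpq
  have hD := monomialDomain_eq m r
  have hDsa : IsSemialgebraic ℚ {v : Fin (m + d + 1) → ℝ | ∃ (s' : ℝ) (η : Fin m → ℝ) (x : Fin d → ℝ),
      v = Matrix.vecCons s' (Fin.append η x) ∧ 0 < s' ∧ s' < 1 ∧ (∀ l, s' ≤ η l ∧ η l ≤ 1) ∧
        x ∈ r.domain} := by
    rw [hD]; exact isSemialgebraic_monomialDomain m r
  refine ⟨⟨_, _, hDsa, ?_, ?_⟩, rfl, rfl⟩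
  · rw [hD]; exact isSemialgebraicFunOn_blowupFibreIntegrand p q m r
  · rw [hD]; exact integrableOn_blowupFibreIntegrand hpq r

end Summit.KontsevichZagierPeriods.ValuedFieldSpecialisation
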